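import Summits.ResolutionOfSingularities.ResolutionOfSingularities.Theorems.HilbertSamuelEliminationSigmaMaxModificationsCorridor3QuadricGapPrincipal
import Summits.ResolutionOfSingularities.ResolutionOfSingularities.Theorems.HilbertSamuelEliminationSigmaMaxModificationsCorridor3RegularPresentation
import Summits.ResolutionOfSingularities.ResolutionOfSingularities.Theorems.HilbertSamuelEliminationSigmaMaxModificationsCorridor3HypersurfaceHilbertFunction
import Literature.AlgebraicGeometry.Resolution.RegularLocalRingsUFD
import Literature.AlgebraicGeometry.Resolution.RegularLocalHeights
import Literature.AlgebraicGeometry.Resolution.HilbertSamuelValues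
import Literature.RingTheory.HilbertSamuel.Quotient
import Literature.RingTheory.HilbertSamuel.MinimalPrimesCodim
import Mathlib.RingTheory.Ideal.MinimalPrime.Localization
import Mathlib.RingTheory.Filtration
import HarnessLib

/-!
# `SigmaMaxModificationsCorridor3` (stmt-19249), line `tame_wild`: the QUADRIC GAP at the ring level

[OURS · L1 W4.2] **No Hilbert–Samuel value of a reduced quotient of a regular local ring lies strictly between
the regular value and the double-point value.** For a reduced Noetherian local ring `A` of dimension `d`
which is a quotient of a regular local ring and is NOT regular: if `H^{(3-ψ(A))}_A ≤ q := hypersurfaceHF 2`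
(termwise), then `H^{(3-ψ(A))}_A = q` (`hilbertSamuelFun_eq_hypersurfaceHF_two_of_le`). Assembly of the
chain's bricks: `H(1) ≤ 4` forces `ψ = d ≤ 3`, `emb.dim = d + 1` (Step 1); a regular presentation of
dimension `d + 1` (`exists_regular_quotient_presentation'`, Step 2); its kernel is radical with height-one
minimal primes (`height_add_ringKrullDim_quotient`), hence principal `(g)` (`eq_span_prod_of_isRadical_of_height_one`,
Auslander–Buchsbaum `IsRegularLocalRing.uniqueFactorizationMonoid`, Step 3); `g` has an exact order `m' ≥ 2`
(Krull intersection; `m' = 1` would make `A` regular, Matsumura 14.2); `H^{(0)}(A) = hypersurfaceHFe (d+1) m'`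
(helper H1′ `hilbertFun_quotient_span_singleton`, stub-1) and `H^{(3-d)} = hypersurfaceHF m'` (H1″); finally
`hypersurfaceHF m' ≤ q` at `n = 2` forces `m' = 2`. This is the ring-level core of the hypothesis `hgap` of
`tameNu3_three_of_quadricGap` (landed): with the scheme plumbing (stalks of finite-type `k`-schemes are
quotients of regular local rings) it makes `stub_tameNu3` VACUOUS for `p ≤ 3`.
NOT a statement of any manuscript. [cite: CossartJannsenSaito2020, Def. 2.28, Lemma 2.23, Thm. 2.3]
[cite: Matsumura1987, Thm. 14.2, Thm. 20.3]
-/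

set_option linter.dupNamespace false -- mandated namespace of this single-conjunct summit

noncomputable section

open IsLocalRing Literature.AlgebraicGeometry.Resolution Literature.RingTheory.HilbertSamuel
open Summit.ResolutionOfSingularities.ResolutionOfSingularities.Theorems.SigmaMaxModificationsCorridor3.Helpers

namespace Summit.ResolutionOfSingularities.ResolutionOfSingularities.Theorems.SigmaMaxModificationsCorridor3.TameWild

universe u

/-- **Step 1 (ring level).** For a non-regular Noetherian local ring `A` of dimension `d` with
`H^{(3 - ψ(A))}_A(1) ≤ 4`: `ψ(A) = d`, `emb.dim A = d + 1` and `d ≤ 3`. [cite: CossartJannsenSaito2020, Def. 2.28] -/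
theorem psi_eq_of_hilbertSamuelFun_one_le (A : Type*) [CommRing A] [IsLocalRing A] [IsNoetherianRing A]
    {d : ℕ} (hd : ringKrullDim A = d) (hreg : ¬ IsRegularLocalRing A)
    (hH : hilbertSamuelFun A (3 - minimalPrimesCodim A) 1 ≤ 4) :
    minimalPrimesCodim A = d ∧ (maximalIdeal A).spanFinrank = d + 1 ∧ d ≤ 3 := by
  have hψ : minimalPrimesCodim A ≤ d := by
    have h := minimalPrimesCodim_le_ringKrullDim A
    rw [hd] at h
    exact_mod_cast h
  have he : d ≤ (maximalIdeal A).spanFinrank := by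
    have h := ringKrullDim_le_spanFinrank_maximalIdeal A
    rw [hd] at h
    exact_mod_cast h
  have hne : (maximalIdeal A).spanFinrank ≠ d := by
    intro h
    exact hreg (IsRegularLocalRing.of_spanFinrank_maximalIdeal_le A (by rw [hd, h]))
  rw [hilbertSamuelFun_apply_one] at hH
  omega

/-- `hypersurfaceHF m' 2 = 10` for `m' ≥ 3` and `hypersurfaceHF 2 2 = 9`: the double-point value is exceeded
in degree `2` by every higher multiplicity. [folklore] -/
theorem hypersurfaceHF_apply_two_of_three_le {m : ℕ} (hm : 3 ≤ m) : hypersurfaceHF m 2 = 10 := by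
  simp only [hypersurfaceHF]
  rw [Nat.choose_eq_zero_of_lt (by omega : 2 + 3 - m < 3)]
  decide

/-- The kernel of a homomorphism to a reduced ring is a radical ideal. [folklore] -/
theorem isRadical_ker_of_isReduced {S A : Type*} [CommRing S] [CommRing A] [IsReduced A]
    (f : S →+* A) : (RingHom.ker f).IsRadical := by
  intro x hx
  obtain ⟨n, hn⟩ := hx
  rw [RingHom.mem_ker, map_pow] at hn
  rw [RingHom.mem_ker]
  exact IsReduced.eq_zero _ ⟨n, hn⟩

/-- **THE QUADRIC GAP (ring level).** [cite: CossartJannsenSaito2020, Def. 2.28, Lemma 2.23, Thm. 2.3]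
[cite: Matsumura1987, Thm. 14.2, Thm. 20.3] -/
theorem hilbertSamuelFun_eq_hypersurfaceHF_two_of_le {S : Type u} [CommRing S] [IsRegularLocalRing S]
    {A : Type u} [CommRing A] [IsLocalRing A] [IsNoetherianRing A] [IsReduced A] (f : S →+* A)
    (hf : Function.Surjective f) {d : ℕ} (hd : ringKrullDim A = d) (hreg : ¬ IsRegularLocalRing A)
    (hH : hilbertSamuelFun A (3 - minimalPrimesCodim A) ≤ hypersurfaceHF 2) :
    hilbertSamuelFun A (3 - minimalPrimesCodim A) = hypersurfaceHF 2 := by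
  classical
  -- Step 1
  have hH1 : hilbertSamuelFun A (3 - minimalPrimesCodim A) 1 ≤ 4 := by
    have h := hH 1
    exact h.trans (by decide)
  obtain ⟨hψ, he, hd3⟩ := psi_eq_of_hilbertSamuelFun_one_le A hd hreg hH1
  -- Step 2: a regular presentation of dimension `d + 1`
  obtain ⟨J, hJ, hregJ, hdimJ⟩ := exists_regular_quotient_presentation' f hf
  haveI := hregJ
  set S' := S ⧸ J with hS'
  let f' : S' →+* A := Ideal.Quotient.lift J f fun a ha => hJ ha
  have hf' : Function.Surjective f' := by
    intro a
    obtain ⟨y, rfl⟩ := hf a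
    exact ⟨Ideal.Quotient.mk _ y, rfl⟩
  have hdimS' : ringKrullDim S' = ((d + 1 : ℕ) : WithBot ℕ∞) := by rw [hdimJ, he]
  have hembS' : (maximalIdeal S').spanFinrank = d + 1 := by
    have h := IsRegularLocalRing.spanFinrank_maximalIdeal (R := S')
    rw [hdimS'] at h
    exact_mod_cast h
  -- Step 3: the kernel is radical with height-one minimal primes, hence principal
  set I : Ideal S' := RingHom.ker f' with hI
  have hIrad : I.IsRadical := isRadical_ker_of_isReduced f'
  haveI : IsDomain S' := isDomain_of_isRegularLocalRing S'
  haveI : UniqueFactorizationMonoid S' := IsRegularLocalRing.uniqueFactorizationMonoid S'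
  have hht : ∀ P ∈ I.minimalPrimes, P.height = 1 := by
    intro P hP
    -- `P = comap f' 𝔭` for a minimal prime `𝔭` of `A`
    have hI' : I = (⊥ : Ideal A).comap f' := by rw [hI, RingHom.ker_eq_comap_bot]
    rw [hI', Ideal.comap_minimalPrimes_eq_of_surjective hf'] at hP
    obtain ⟨𝔭, h𝔭, rfl⟩ := hP
    haveI : 𝔭.IsPrime := h𝔭.1.1
    haveI : (Ideal.comap f' 𝔭).IsPrime := Ideal.comap_isPrime f' 𝔭
    -- `S'/P ≅ A/𝔭`
    have hsurj : Function.Surjective ((Ideal.Quotient.mk 𝔭).comp f') :=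
      Ideal.Quotient.mk_surjective.comp hf'
    have hker : RingHom.ker ((Ideal.Quotient.mk 𝔭).comp f') = Ideal.comap f' 𝔭 := by
      rw [← RingHom.comap_ker, Ideal.mk_ker]
    let e : S' ⧸ Ideal.comap f' 𝔭 ≃+* A ⧸ 𝔭 :=
      (Ideal.quotEquivOfEq hker.symm).trans (RingHom.quotientKerEquivOfSurjective hsurj)
    -- `dim A/𝔭 = d`
    obtain ⟨n, hn⟩ := exists_ringKrullDim_quotient_eq_nat A 𝔭
    have hψn : minimalPrimesCodim A ≤ n := minimalPrimesCodim_le A (by exact h𝔭) hn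
    have hnd : (n : WithBot ℕ∞) ≤ d := by
      rw [← hn, ← hd]
      exact ringKrullDim_quotient_le 𝔭
    have hnd' : n ≤ d := by exact_mod_cast hnd
    have hn_eq : n = d := by omega
    have hdimP : ringKrullDim (S' ⧸ Ideal.comap f' 𝔭) = (d : WithBot ℕ∞) := by
      rw [ringKrullDim_eq_of_ringEquiv e, hn, hn_eq]
    -- height formula in the regular local ring `S'`
    have hform := height_add_ringKrullDim_quotient (S := S') (Ideal.comap f' 𝔭)
    rw [hdimP, hdimS'] at hform
    have hfin : (Ideal.comap f' 𝔭).height ≠ ⊤ := Ideal.height_ne_top_of_isPrime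
    obtain ⟨h₀, hh₀⟩ := ENat.ne_top_iff_exists.mp hfin
    rw [← hh₀] at hform ⊢
    have hform' : ((h₀ + d : ℕ) : WithBot ℕ∞) = ((d + 1 : ℕ) : WithBot ℕ∞) := by
      rw [← hform]; push_cast; rfl
    have : h₀ + d = d + 1 := by exact_mod_cast hform'
    have : h₀ = 1 := by omega
    subst this
    rfl
  obtain ⟨T, gen, -, hgen, hIeq⟩ := eq_span_prod_of_isRadical_of_height_one hIrad hht
  set g : S' := ∏ P ∈ T, gen P with hg
  -- the exact order of `g`
  have hInetop : I ≠ ⊤ := RingHom.ker_ne_top f'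
  have hgm : g ∈ maximalIdeal S' := by
    have : g ∈ I := by rw [hIeq]; exact Ideal.mem_span_singleton_self g
    exact IsLocalRing.le_maximalIdeal hInetop this
  have hIne : I ≠ ⊥ := by
    intro hbot
    apply hreg
    have hinj : Function.Injective f' := by
      rw [RingHom.injective_iff_ker_eq_bot]; exact hbot
    exact IsRegularLocalRing.of_ringEquiv (RingEquiv.ofBijective f' ⟨hinj, hf'⟩)
  have hg0 : g ≠ 0 := by
    intro h0
    apply hIne
    rw [hIeq, h0, Ideal.span_singleton_eq_bot]
  have hex : ∃ n : ℕ, g ∉ maximalIdeal S' ^ n := by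
    by_contra hall
    simp only [not_exists, not_not] at hall
    have hmem : g ∈ ⨅ n : ℕ, maximalIdeal S' ^ n := Ideal.mem_iInf.mpr hall
    rw [Ideal.iInf_pow_eq_bot_of_isLocalRing _ (IsLocalRing.maximalIdeal.isMaximal S').ne_top] at hmem
    exact hg0 hmem
  let N := Nat.find hex
  have hN : g ∉ maximalIdeal S' ^ N := Nat.find_spec hex
  have hN1 : 1 ≤ N := by
    by_contra h
    have h0 : N = 0 := by omega
    apply hN
    rw [h0, pow_zero, Ideal.one_eq_top]
    exact Submodule.mem_top
  obtain ⟨m', hm'⟩ : ∃ m' : ℕ, N = m' + 1 := ⟨N - 1, by omega⟩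
  have hgm' : g ∈ maximalIdeal S' ^ m' := by
    have h := Nat.find_min hex (m := m') (by omega)
    simpa using h
  have hgm'1 : g ∉ maximalIdeal S' ^ (m' + 1) := hm' ▸ hN
  -- `A ≅ S'/(g)`, a local ring
  have hkerg : RingHom.ker f' = Ideal.span {g} := hIeq
  haveI : Nontrivial (S' ⧸ Ideal.span {g}) :=
    Ideal.Quotient.nontrivial_iff.mpr (Ideal.span_singleton_ne_top hgm)
  haveI : IsLocalRing (S' ⧸ Ideal.span {g}) := .of_surjective' _ Ideal.Quotient.mk_surjective
  let eA : (S' ⧸ Ideal.span {g}) ≃+* A :=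
    (Ideal.quotEquivOfEq hkerg.symm).trans (RingHom.quotientKerEquivOfSurjective hf')
  -- `m' ≥ 2`: otherwise `A` would be regular
  have hm'1 : 1 ≤ m' := by
    by_contra h
    have h0 : m' = 0 := by omega
    rw [h0, zero_add, pow_one] at hgm'1
    exact hgm'1 hgm
  have hm'2 : 2 ≤ m' := by
    by_contra h
    have h1 : m' = 1 := by omega
    rw [h1] at hgm'1
    have hq := (IsRegularLocalRing.quotient_span_singleton hgm hgm'1).1
    exact hreg (IsRegularLocalRing.of_ringEquiv eA)
  -- H1′ and H1″
  have hHA : hilbertFun A = hypersurfaceHFe (d + 1) m' := by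
    rw [← hilbertFun_eq_of_ringEquiv eA]
    exact hilbertFun_quotient_span_singleton hembS' hgm' hgm'1
  have hHS : hilbertSamuelFun A (3 - minimalPrimesCodim A) = hypersurfaceHF m' := by
    rw [hψ, show hilbertSamuelFun A (3 - d) = iterPSum (3 - d) (hilbertFun A) from rfl, hHA,
      iterPSum_hypersurfaceHFe_succ, show d + 1 + (3 - d) = 4 by omega, hypersurfaceHFe_four]
  -- compare at degree `2`
  rw [hHS] at hH ⊢
  have h2 : hypersurfaceHF m' 2 ≤ hypersurfaceHF 2 2 := hH 2
  by_contra hne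
  have hm'3 : 3 ≤ m' := by
    by_contra h
    exact hne (by rw [show m' = 2 by omega])
  rw [hypersurfaceHF_apply_two_of_three_le hm'3] at h2
  exact absurd h2 (by decide)

end Summit.ResolutionOfSingularities.ResolutionOfSingularities.Theorems.SigmaMaxModificationsCorridor3.TameWild

end
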